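import Literature.MathematicalPhysics.QuantumFieldTheory.Balaban1983to89.T4AveragingDisintegration
import Literature.MathematicalPhysics.QuantumFieldTheory.Balaban1983to89.T4LevelShift

/-!
# T⁴ programme, node U5b/U5.E — THE WINDOW RELABELLING IS THE LEVEL SHIFT: the block-map bookkeeping of design (W)
# (owed item (o6) of record `t4/T4-EST-U5bE2.md` §17.4/§18.3, made kernel; cell `pub-balaban`, estimate row T4-U5b.E2, lineage pv07,
# journal self-row T4-U5b.E2-ETA-WINDOWSHIFT°; version tag v1 (2026-08-19); LOW BRIDGE LEAF: imports `T4AveragingDisintegration`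
# v1.3 and `T4LevelShift` only; ADDITIVE — no existing module is modified)

HONEST FRAMING.  This module is KERNEL BOOKKEEPING for the cell's η-design (two runs `K_A`, `K_B` of Bałaban's renormalization
group typed on ONE window space, `T4AveragingDisintegration` §6/§7).  It proves NO estimate of [Balaban1988RG2] /
[Balaban1989LargeFieldII], quotes NO sentence of Bałaban's series, carries NO cite tag, and asserts nothing printed: every
declaration is a finite combinatorial identity about the tree's own typed objects (`Setup.Params`/`Site`/`PBond`/`GaugeField`,
`T4Continuum.T4Family`, `T4LevelShift.siteShift`/`bondShift`/`fieldShift`, `T4AveragingDisintegration.relabel`/`window`/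
`windowBondEquiv`/`towerMap`, `BlockAveraging.avgFun`, `BlockAveragingTwoLevel.avgFun₂`) and is tagged [folklore].  NOT summit
progress; rung (B)+1 bookkeeping on one four-torus; NOT infinite volume, NOT a mass gap, NOT the Clay problem.

## Why (owed item (o6) of the η-design)

`T4AveragingDisintegration` §7 types the window presentation of design (W): run `X`'s gauge fields at its level `K_X − N_W + j'`
are RELABELLED onto level `j'` of the `K`-independent window record `window P N_W := ⟨d, L, m, N_W⟩` along the bond equivalence
`windowBondEquiv P hNW j'` (`relabel ε U := U ∘ ε`; product Haar ↦ product Haar exactly), and `termRepr_window(_SUN)_relabel`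
consumes a printed term's young slot variables `uX K τ i` as functions ON THE WINDOW.  What (o6) still owed after §7 (its header,
HONEST SCOPE) is the BOOKKEEPING that such a slot variable — a further block average of the window field, read in a plaquette —
is run `X`'s OWN further block average read through the relabelling: compatibility of the block maps `Setup.blockOf`/`emb` with
`siteEquiv`, and of `BlockAveraging.avgFun` with `relabel`.  In the cell's parameter family `T4Family` (the only setting in which a
consumer of §7 lives: `d = 4`, `L`, `m` shared by all runs) the sibling leaf `T4LevelShift` (unit t4-lean) ALREADY proves that
Bałaban's block averagings (0.4)/(0.12) are level-homogeneous under the label-on-label identification `siteShift`/`bondShift`/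
`fieldShift` of two levels with equal moduli.  This leaf is the BRIDGE between the two vocabularies plus the tower induction.

## What this file adds (and only this)

§1 THE WINDOW RECORD IS A RUN RECORD: `window (F.P K) N_W = F.P N_W` (`rfl`), and the modulus family of the window shift
   `sitesPerDir_windowShift : (F.P N_W).sitesPerDir (j' + i) = (F.P K).sitesPerDir (K − N_W + j' + i)` (`N_W ≤ K`, all `i`).
§2 THE BRIDGE: `siteEquiv_symm` / `bondEquiv_symm` (abstract `Params`: the inverse identification is the identification along the
   symmetric equalities, `ZMod.ringEquivCongr_symm`), `windowBondEquiv_eq` (the window relabelling is a `bondEquiv`); in the family: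
   `siteEquiv rfl h = siteShift h`, `bondEquiv rfl h = bondShift h`, `windowBondEquiv (F.P K) hNW j' = bondShift _`,
   `relabel (bondShift h) = fieldShift h` (`rfl`), `relabel (windowBondEquiv (F.P K) hNW j') = fieldShift _` (also primed variants
   `relabel_windowBondEquiv'`/`_apply'` with `relabel` elaborated at the `N_W`-th run's field type, for `rw` in such goals — the window
   record and `F.P N_W` are definitionally, not syntactically, equal), integer site labels and directions are preserved
   (`windowBondEquiv_P_src_val`/`_dir`); hence the block maps
   `blockOf` / `emb` / `offSite` commute with `siteEquiv` BY NAME from `T4LevelShift.siteShift_blockOf` / `siteShift_emb` /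
   `siteShift_offSite` (`siteEquiv_blockOf`, `siteEquiv_emb`, `siteEquiv_offSite`).
§3 TOWERS: for two level-indexed one-step families `avg` (run `K`) / `avg'` (run `K'`) natural under `fieldShift` along a modulus
   family `hs i : (F.P K).sitesPerDir (lvl + i) = (F.P K').sitesPerDir (lvl' + i)`, the `k`-step tower maps are natural:
   `towerMap avg lvl k (fieldShift (hs 0) V) = fieldShift (hs k) (towerMap avg' lvl' k V)` (`towerMap_fieldShift`, induction on `k`);
   instances `avgFun ℰ` (every small-loop average `ℰ`, by `avgFun_fieldShift`) and `avgFun₂ 𝓜 ℰ` (by `avgFun₂_fieldShift`); and the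
   composition of towers inside one run with the `ℕ`-associativity transport made explicit as a same-run `fieldShift`:
   `towerMap avg (lvl + k) k₂ (towerMap avg lvl k U) = fieldShift _ (towerMap avg lvl (k + k₂) U)` (`towerMap_towerMap`).
§4 THE (o6) IDENTITIES: `towerMap (avgFun ℰ) j' k₂ (relabel (windowBondEquiv (F.P K) hNW j') U) = fieldShift _ (towerMap (avgFun ℰ)
   (K − N_W + j') k₂ U)` — further block averages ON THE WINDOW of the relabelled run-`X` field are run `X`'s own further averages,
   relabelled (`towerMap_avgFun_relabel_window`; two-level twin `towerMap_avgFun₂_relabel_window`); and, for the shape consumed by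
   `termRepr_window(_SUN)_relabel` (`ε K τ : PBond (PW K τ) (jW K τ) ≃ PBond (Pf K τ) (lvl K τ + k K τ)`, best instantiated as
   `bondShift (hs' 0)` along ANY modulus equality — no `K − N_W + j'` arithmetic in the index), the composite reading
   `towerMap (avgFun ℰ) j' k₂ (relabel (bondShift (hs' 0)) (towerMap (avgFun ℰ) lvl k U)) = relabel (bondShift _) (towerMap (avgFun ℰ)
   lvl (k + k₂) U)` (`towerMap_relabel_towerMap`): the window's young variables are run `X`'s `(k + k₂)`-fold averages of its own
   level-`lvl` field (`slot_relabel_towerMap`: any functional of the window's averages, e.g. a plaquette variable, agrees).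
   Measure bookkeeping by name: `map_relabel_windowBondEquiv_P` / `measurePreserving_relabel_windowBondEquiv` (instances of
   `map_relabel_fieldMeasure` / `measurePreserving_fieldShift`: product Haar of run `K` at level `K − N_W + j'` ↦ product Haar of
   run `N_W` at level `j'`, exactly).
§5 SANITY on a concrete family (`L = 13`, `m = 1`): the records agree by `rfl`, the identities fire with numerals, and the window
   relabelling preserves integer site labels.

WHAT IS NOT PROVED / VALUE.  Nothing analytic.  The finest-level `TermRepr` of a printed term (owed item (o1), node U5d/U0), the
closeness `SupClose` of the young slot variables (o3), the per-run `ShellWeightBound` (o4) and node U5b's two-run factor ledger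
`hsw` are NOT touched.  VALUE = the (o6) residual of the η-design is discharged in the kernel for Bałaban's printed block averagings
(0.4)/(0.12) typed as `BlockAveraging.avgFun ℰ` / `BlockAveragingTwoLevel.avgFun₂ 𝓜 ℰ`, in the cell's family `T4Family`.

DIVERGENCE (cell row D-pv07.24).  (a) As `T4LevelShift` D-t4l.18 (b) and record §18: everything is specific to `T4Family`
(`d = 4`, `L`, `m` shared by all runs, so `window (F.P K) N_W` and `F.P N_W` agree by `rfl`); a two-abstract-`Params` naturality of
`avgFun` under `relabel ∘ bondEquiv hd hs` would carry a cast of `Fin d` through `BlockAveraging.Idx`/`loopWord` and has no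
consumer.  (b) The composition of towers is stated with an explicit same-run `fieldShift` along `lvl + k + k₂ = lvl + (k + k₂)`
(the two index forms are propositionally, not definitionally, equal types); `fieldShift` along a reflexive modulus equality is the
identity (`T4LevelShift.fieldShift_refl`), so no information is carried by the transport.

Upstream: `T4AveragingDisintegration` v1.3 (pv07), `T4LevelShift` (t4-lean).  Consumers (by name, nothing of theirs edited): the
seat typing (o1) (a printed term's young auxiliaries as the finest-level `TermRepr` fed to `termRepr_window_SUN_relabel`).
-/

noncomputable section

open MeasureTheory

namespace Literature.MathematicalPhysics.QuantumFieldTheory.Balaban1983to89.T4WindowLevelShift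

open T4Continuum T4LevelShift T4AveragingDisintegration BlockAveraging BlockAveragingTwoLevel

/-! ## §1 The window record of a run of the family is the `N_W`-th run's record; the modulus family of the window shift -/

section Window

variable (F : T4Family)

/-- **THE WINDOW RECORD IS A RUN RECORD**: `window (F.P K) N_W = F.P N_W` — same `d = 4`, `L`, `m`, cutoff parameter `N_W` — by
`rfl`.  Hence every object of the window (`Site`, `PBond`, `GaugeField`, `fieldMeasure`, `avgFun`, …) IS the corresponding object
of the `N_W`-th run. [folklore] -/
theorem window_P (K NW : ℕ) : window (F.P K) NW = F.P NW := rfl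

/-- Sites per direction of the window record, read on the `N_W`-th run. [folklore] -/
theorem sitesPerDir_window_P (K NW j' : ℕ) : (window (F.P K) NW).sitesPerDir j' = (F.P NW).sitesPerDir j' := rfl

/-- The shift relation of the window presentation: `N_W + (K − N_W + j') = K + j'` for `N_W ≤ K`. [folklore] -/
theorem windowShift_eq {K NW : ℕ} (hNW : NW ≤ K) (j' : ℕ) : NW + (K - NW + j') = K + j' := by
  omega

/-- **THE MODULUS FAMILY OF THE WINDOW SHIFT**: for `N_W ≤ K`, level `j' + i` of the `N_W`-th run (= of the window record) and level
`K − N_W + j' + i` of the `K`-th run have the same number of sites per direction, for every `i`. [folklore] -/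
theorem sitesPerDir_windowShift {K NW : ℕ} (hNW : NW ≤ K) (j' i : ℕ) :
    (F.P NW).sitesPerDir (j' + i) = (F.P K).sitesPerDir (K - NW + j' + i) :=
  sitesPerDir_eq_of_shift F (windowShift_eq hNW j') i

/-- The case `i = 0`, in the form of `T4AveragingDisintegration.sitesPerDir_window`. [folklore] -/
theorem windowModulus {K NW : ℕ} (hNW : NW ≤ K) (j' : ℕ) :
    (F.P NW).sitesPerDir j' = (F.P K).sitesPerDir (K - NW + j') :=
  sitesPerDir_windowShift F hNW j' 0

/-- Consistency with `T4AveragingDisintegration.sitesPerDir_window` (which states the same equality on the window record). [folklore] -/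
theorem windowModulus_eq_symm {K NW : ℕ} (hNW : NW ≤ K) (j' : ℕ) :
    windowModulus F hNW j' = (sitesPerDir_window (F.P K) hNW j').symm := rfl

/-- Same-run transport along `ℕ`-associativity of the level index. [folklore] -/
theorem sitesPerDir_assoc (K lvl k i : ℕ) : (F.P K).sitesPerDir (lvl + k + i) = (F.P K).sitesPerDir (lvl + (k + i)) := by
  rw [Nat.add_assoc]

end Window

/-! ## §2 The bridge: `siteEquiv` / `bondEquiv` / `windowBondEquiv` / `relabel` of `T4AveragingDisintegration` §7 versus
`siteShift` / `bondShift` / `fieldShift` of `T4LevelShift` -/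

section AbstractSymm

variable {P P' : Params} {j j' : ℕ}

/-- Pointwise formula for the inverse site identification. [folklore] -/
theorem siteEquiv_symm_apply (hd : P.d = P'.d) (hs : P.sitesPerDir j = P'.sitesPerDir j') (x' : Site P' j') (μ : Fin P.d) :
    (siteEquiv hd hs).symm x' μ = (ZMod.ringEquivCongr hs).symm (x' (Fin.cast hd μ)) := rfl

/-- **The inverse identification of sites is the identification along the symmetric equalities.** [folklore] -/
theorem siteEquiv_symm (hd : P.d = P'.d) (hs : P.sitesPerDir j = P'.sitesPerDir j') :
    (siteEquiv hd hs).symm = siteEquiv hd.symm hs.symm := by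
  apply Equiv.ext
  intro x'
  funext μ
  show (ZMod.ringEquivCongr hs).symm (x' (Fin.cast hd μ)) = ZMod.ringEquivCongr hs.symm (x' (Fin.cast hd μ))
  rw [ZMod.ringEquivCongr_symm]

/-- Components of the inverse bond identification. [folklore] -/
theorem bondEquiv_symm_apply_src (hd : P.d = P'.d) (hs : P.sitesPerDir j = P'.sitesPerDir j') (b' : PBond P' j') :
    ((T4AveragingDisintegration.bondEquiv hd hs).symm b').src = (siteEquiv hd hs).symm b'.src := rfl

/-- Components of the inverse bond identification. [folklore] -/
theorem bondEquiv_symm_apply_dir (hd : P.d = P'.d) (hs : P.sitesPerDir j = P'.sitesPerDir j') (b' : PBond P' j') :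
    ((T4AveragingDisintegration.bondEquiv hd hs).symm b').dir = Fin.cast hd.symm b'.dir := rfl

/-- **The inverse identification of bonds is the identification along the symmetric equalities.** [folklore] -/
theorem bondEquiv_symm (hd : P.d = P'.d) (hs : P.sitesPerDir j = P'.sitesPerDir j') :
    (T4AveragingDisintegration.bondEquiv hd hs).symm = T4AveragingDisintegration.bondEquiv hd.symm hs.symm := by
  apply Equiv.ext
  intro b'
  show (⟨(siteEquiv hd hs).symm b'.src, Fin.cast hd.symm b'.dir⟩ : PBond P j) =
    ⟨siteEquiv hd.symm hs.symm b'.src, Fin.cast hd.symm b'.dir⟩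
  rw [siteEquiv_symm]

/-- **The window relabelling is a `bondEquiv`** (from the window record to `P`, along the symmetric numerology). [folklore] -/
theorem windowBondEquiv_eq (P : Params) {NW : ℕ} (hNW : NW ≤ P.K) (j' : ℕ) :
    windowBondEquiv P hNW j' =
      T4AveragingDisintegration.bondEquiv (P := window P NW) (P' := P) rfl (sitesPerDir_window P hNW j').symm :=
  bondEquiv_symm _ _

end AbstractSymm

section Bridge

variable {F : T4Family} {K j K' j' : ℕ}

/-- **`siteEquiv` IS `siteShift`** in the family (`d = 4` on both sides by `rfl`). [folklore] -/
theorem siteEquiv_eq_siteShift (h : (F.P K).sitesPerDir j = (F.P K').sitesPerDir j') :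
    siteEquiv (P := F.P K) (P' := F.P K') rfl h = siteShift h := by
  apply Equiv.ext
  intro x
  funext ν
  rfl

/-- **`bondEquiv` IS `bondShift`** in the family. [folklore] -/
theorem bondEquiv_eq_bondShift (h : (F.P K).sitesPerDir j = (F.P K').sitesPerDir j') :
    T4AveragingDisintegration.bondEquiv (P := F.P K) (P' := F.P K') rfl h = bondShift h := by
  apply Equiv.ext
  intro b
  rfl

/-- The inverse of `siteShift h` is `siteShift h.symm`. [folklore] -/
theorem siteShift_symm (h : (F.P K).sitesPerDir j = (F.P K').sitesPerDir j') : (siteShift h).symm = siteShift h.symm := by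
  apply Equiv.ext
  intro y
  funext ν
  show (coordEquiv h).symm (y ν) = coordEquiv h.symm (y ν)
  simp only [coordEquiv, ZMod.ringEquivCongr_symm]

/-- The inverse of `bondShift h` is `bondShift h.symm`. [folklore] -/
theorem bondShift_symm (h : (F.P K).sitesPerDir j = (F.P K').sitesPerDir j') : (bondShift h).symm = bondShift h.symm := by
  apply Equiv.ext
  intro b
  show (⟨(siteShift h).symm b.src, b.dir⟩ : PBond (F.P K) j) = ⟨siteShift h.symm b.src, b.dir⟩
  rw [siteShift_symm]

variable (F)

/-- **THE WINDOW RELABELLING IS THE LEVEL SHIFT**: `windowBondEquiv (F.P K) hNW j'` is `bondShift` along the window modulus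
(level `j'` of the `N_W`-th run ≃ level `K − N_W + j'` of the `K`-th run). [folklore] -/
theorem windowBondEquiv_P {K NW : ℕ} (hNW : NW ≤ K) (j' : ℕ) :
    windowBondEquiv (F.P K) hNW j' =
      bondShift (F := F) (K := NW) (j := j') (K' := K) (j' := K - NW + j') (windowModulus F hNW j') :=
  (windowBondEquiv_eq (F.P K) hNW j').trans (bondEquiv_eq_bondShift _)

/-- Pointwise form. [folklore] -/
theorem windowBondEquiv_P_apply {K NW : ℕ} (hNW : NW ≤ K) (j' : ℕ) (b : PBond (F.P NW) j') :
    windowBondEquiv (F.P K) hNW j' b =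
      bondShift (F := F) (K := NW) (j := j') (K' := K) (j' := K - NW + j') (windowModulus F hNW j') b := by
  rw [windowBondEquiv_P]
  rfl

/-- **The window relabelling preserves integer site labels** (`ZMod.val` coordinatewise) and directions. [folklore] -/
theorem windowBondEquiv_P_src_val {K NW : ℕ} (hNW : NW ≤ K) (j' : ℕ) (b : PBond (F.P NW) j') (ν : Fin 4) :
    ((windowBondEquiv (F.P K) hNW j' b).src ν).val = (b.src ν).val := by
  rw [windowBondEquiv_P_apply]
  exact coordEquiv_val _ _

/-- [folklore] -/
theorem windowBondEquiv_P_dir {K NW : ℕ} (hNW : NW ≤ K) (j' : ℕ) (b : PBond (F.P NW) j') :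
    (windowBondEquiv (F.P K) hNW j' b).dir = b.dir := by
  rw [windowBondEquiv_P_apply]
  rfl

variable {F} {G : Type*}

/-- **`relabel` ALONG `bondShift` IS `fieldShift`** (`rfl`: both are `U ↦ U ∘ bondShift h`). [folklore] -/
theorem relabel_bondShift (h : (F.P K).sitesPerDir j = (F.P K').sitesPerDir j') :
    relabel (G := G) (bondShift h) = fieldShift h := rfl

variable (F)

/-- **THE WINDOW RELABELLING OF FIELDS IS THE LEVEL SHIFT OF FIELDS.** [folklore] -/
theorem relabel_windowBondEquiv {K NW : ℕ} (hNW : NW ≤ K) (j' : ℕ) :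
    relabel (G := G) (windowBondEquiv (F.P K) hNW j') =
      fieldShift (F := F) (K := NW) (j := j') (K' := K) (j' := K - NW + j') (windowModulus F hNW j') := by
  rw [windowBondEquiv_P]
  rfl

/-- Pointwise form. [folklore] -/
theorem relabel_windowBondEquiv_apply {K NW : ℕ} (hNW : NW ≤ K) (j' : ℕ) (U : GaugeField (F.P K) (K - NW + j') G) :
    relabel (windowBondEquiv (F.P K) hNW j') U =
      fieldShift (F := F) (K := NW) (j := j') (K' := K) (j' := K - NW + j') (windowModulus F hNW j') U := by
  rw [relabel_windowBondEquiv F hNW j']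

variable {F}

/-- The same identity with `relabel` elaborated AT THE `N_W`-TH RUN'S FIELD TYPE — the syntactic form a goal takes when
`relabel (windowBondEquiv (F.P K) hNW j') U` is fed to a map on `GaugeField (F.P N_W) j' G` (e.g. the window's `towerMap`); use this
variant with `rw` there (the two forms are definitionally, not syntactically, equal). [folklore] -/
theorem relabel_windowBondEquiv' {K NW : ℕ} (hNW : NW ≤ K) (j' : ℕ) :
    relabel (P := F.P K) (P' := F.P NW) (j := (F.P K).K - NW + j') (j' := j') (G := G)
        (windowBondEquiv (F.P K) hNW j') =
      fieldShift (F := F) (K := NW) (j := j') (K' := K) (j' := K - NW + j') (windowModulus F hNW j') :=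
  relabel_windowBondEquiv F hNW j'

/-- Pointwise form of `relabel_windowBondEquiv'`. [folklore] -/
theorem relabel_windowBondEquiv_apply' {K NW : ℕ} (hNW : NW ≤ K) (j' : ℕ) (U : GaugeField (F.P K) (K - NW + j') G) :
    relabel (P := F.P K) (P' := F.P NW) (j := (F.P K).K - NW + j') (j' := j') (G := G)
        (windowBondEquiv (F.P K) hNW j') U =
      fieldShift (F := F) (K := NW) (j := j') (K' := K) (j' := K - NW + j') (windowModulus F hNW j') U :=
  relabel_windowBondEquiv_apply F hNW j' U

/-- **`siteEquiv` COMMUTES WITH THE BLOCK MAP** `blockOf` (`⌊x_μ / L⌋`), the two level pairs being matched — by name from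
`T4LevelShift.siteShift_blockOf`. [folklore] -/
theorem siteEquiv_blockOf (h₀ : (F.P K).sitesPerDir j = (F.P K').sitesPerDir j')
    (h₁ : (F.P K).sitesPerDir (j + 1) = (F.P K').sitesPerDir (j' + 1)) (x : Site (F.P K) j) :
    siteEquiv (P := F.P K) (P' := F.P K') rfl h₁ (blockOf x) = blockOf (siteEquiv (P := F.P K) (P' := F.P K') rfl h₀ x) := by
  rw [siteEquiv_eq_siteShift, siteEquiv_eq_siteShift]
  exact siteShift_blockOf h₀ h₁ x

/-- **`siteEquiv` COMMUTES WITH THE BLOCK-CENTRE EMBEDDING** `emb` (`y ↦ L·y + (L−1)/2`) — by name from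
`T4LevelShift.siteShift_emb`. [folklore] -/
theorem siteEquiv_emb (h₀ : (F.P K).sitesPerDir j = (F.P K').sitesPerDir j')
    (h₁ : (F.P K).sitesPerDir (j + 1) = (F.P K').sitesPerDir (j' + 1)) (y : Site (F.P K) (j + 1)) :
    siteEquiv (P := F.P K) (P' := F.P K') rfl h₀ (emb y) = emb (siteEquiv (P := F.P K) (P' := F.P K') rfl h₁ y) := by
  rw [siteEquiv_eq_siteShift, siteEquiv_eq_siteShift]
  exact siteShift_emb h₀ h₁ y

/-- **`siteEquiv` COMMUTES WITH THE OFFSET SITES** `offSite y n = emb y + n` of the two-level averaging (0.12) — by name from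
`T4LevelShift.siteShift_offSite`. [folklore] -/
theorem siteEquiv_offSite (h₀ : (F.P K).sitesPerDir j = (F.P K').sitesPerDir j')
    (h₁ : (F.P K).sitesPerDir (j + 1) = (F.P K').sitesPerDir (j' + 1)) (y : Site (F.P K) (j + 1)) (n : Fin (F.P K).d → ℤ) :
    siteEquiv (P := F.P K) (P' := F.P K') rfl h₀ (offSite y n) = offSite (siteEquiv (P := F.P K) (P' := F.P K') rfl h₁ y) n := by
  rw [siteEquiv_eq_siteShift, siteEquiv_eq_siteShift]
  exact siteShift_offSite h₀ h₁ y n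

end Bridge

/-! ## §3 Towers of one-step averagings are natural under the level identification; composition of towers -/

section Tower

variable {F : T4Family} {G : Type*} {K lvl K' lvl' : ℕ}

/-- **NATURALITY OF TOWERS.**  Two level-indexed one-step families `avg` (run `K`) and `avg'` (run `K'`) natural under `fieldShift`
along a modulus family `hs` have natural `k`-step tower maps: `towerMap avg lvl k ∘ fieldShift (hs 0) = fieldShift (hs k) ∘
towerMap avg' lvl' k`. [folklore] -/
theorem towerMap_fieldShift (avg : (j : ℕ) → GaugeField (F.P K) j G → GaugeField (F.P K) (j + 1) G)
    (avg' : (j : ℕ) → GaugeField (F.P K') j G → GaugeField (F.P K') (j + 1) G)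
    (hs : ∀ i, (F.P K).sitesPerDir (lvl + i) = (F.P K').sitesPerDir (lvl' + i))
    (hnat : ∀ (i : ℕ) (V : GaugeField (F.P K') (lvl' + i) G),
      avg (lvl + i) (fieldShift (hs i) V) = fieldShift (hs (i + 1)) (avg' (lvl' + i) V)) :
    ∀ (k : ℕ) (V : GaugeField (F.P K') lvl' G),
      towerMap avg lvl k (fieldShift (hs 0) V) = fieldShift (hs k) (towerMap avg' lvl' k V)
  | 0, _ => rfl
  | k + 1, V => by
    show avg (lvl + k) (towerMap avg lvl k (fieldShift (hs 0) V)) =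
      fieldShift (hs (k + 1)) (avg' (lvl' + k) (towerMap avg' lvl' k V))
    rw [towerMap_fieldShift avg avg' hs hnat k V]
    exact hnat k _

/-- A level-indexed family respects the same-run transport along an equality of level indices (both transports are identities).
[folklore] -/
theorem avg_fieldShift_of_eq (avg : (j : ℕ) → GaugeField (F.P K) j G → GaugeField (F.P K) (j + 1) G) {j₁ j₂ : ℕ}
    (e : j₁ = j₂) (h₀ : (F.P K).sitesPerDir j₁ = (F.P K).sitesPerDir j₂)
    (h₁ : (F.P K).sitesPerDir (j₁ + 1) = (F.P K).sitesPerDir (j₂ + 1)) (V : GaugeField (F.P K) j₂ G) :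
    avg j₁ (fieldShift h₀ V) = fieldShift h₁ (avg j₂ V) := by
  subst e
  rw [fieldShift_refl, fieldShift_refl]

/-- **COMPOSITION OF TOWERS** inside one run: `k₂` further steps after `k` steps are `k + k₂` steps from the original level, the two
index forms `lvl + k + k₂` / `lvl + (k + k₂)` being transported by the (identity) same-run `fieldShift`. [folklore] -/
theorem towerMap_towerMap (avg : (j : ℕ) → GaugeField (F.P K) j G → GaugeField (F.P K) (j + 1) G) (lvl k : ℕ) :
    ∀ (k₂ : ℕ) (U : GaugeField (F.P K) lvl G),
      towerMap avg (lvl + k) k₂ (towerMap avg lvl k U) =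
        fieldShift (sitesPerDir_assoc F K lvl k k₂) (towerMap avg lvl (k + k₂) U)
  | 0, U => (fieldShift_refl _ _).symm
  | k₂ + 1, U => by
    show avg (lvl + k + k₂) (towerMap avg (lvl + k) k₂ (towerMap avg lvl k U)) =
      fieldShift _ (avg (lvl + (k + k₂)) (towerMap avg lvl (k + k₂) U))
    rw [towerMap_towerMap avg lvl k k₂ U]
    exact avg_fieldShift_of_eq avg (Nat.add_assoc lvl k k₂) _ _ _

variable [GaugeGroup G]

/-- **BAŁABAN'S BLOCK-AVERAGING TOWERS (0.4) ARE NATURAL under the level identification**, for every small-loop average `ℰ`.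
[folklore] -/
theorem towerMap_avgFun_fieldShift (ℰ : LoopAverage G)
    (hs : ∀ i, (F.P K).sitesPerDir (lvl + i) = (F.P K').sitesPerDir (lvl' + i)) (k : ℕ) (V : GaugeField (F.P K') lvl' G) :
    towerMap (fun j => (avgFun ℰ : GaugeField (F.P K) j G → GaugeField (F.P K) (j + 1) G)) lvl k (fieldShift (hs 0) V) =
      fieldShift (hs k)
        (towerMap (fun j => (avgFun ℰ : GaugeField (F.P K') j G → GaugeField (F.P K') (j + 1) G)) lvl' k V) :=
  towerMap_fieldShift _ _ hs (fun i V => avgFun_fieldShift ℰ (hs i) (hs (i + 1)) V) k V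

/-- **THE TWO-LEVEL AVERAGING TOWERS (0.12) ARE NATURAL under the level identification**, for every group average `𝓜` and
small-loop average `ℰ`. [folklore] -/
theorem towerMap_avgFun₂_fieldShift (𝓜 : GroupAverage G) (ℰ : LoopAverage G)
    (hs : ∀ i, (F.P K).sitesPerDir (lvl + i) = (F.P K').sitesPerDir (lvl' + i)) (k : ℕ) (V : GaugeField (F.P K') lvl' G) :
    towerMap (fun j => (avgFun₂ 𝓜 ℰ : GaugeField (F.P K) j G → GaugeField (F.P K) (j + 1) G)) lvl k (fieldShift (hs 0) V) =
      fieldShift (hs k)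
        (towerMap (fun j => (avgFun₂ 𝓜 ℰ : GaugeField (F.P K') j G → GaugeField (F.P K') (j + 1) G)) lvl' k V) :=
  towerMap_fieldShift _ _ hs (fun i V => avgFun₂_fieldShift 𝓜 ℰ (hs i) (hs (i + 1)) V) k V

end Tower

/-! ## §4 The (o6) identities: further block averages ON THE WINDOW of the relabelled field are the run's own further averages -/

section WindowTower

variable (F : T4Family) {G : Type*} [GaugeGroup G]

/-- **(o6), BLOCK AVERAGING (0.4)**: for `N_W ≤ K`, `U` a field of the `K`-th run at level `K − N_W + j'`, and every `k₂`,
the `k₂`-fold block average ON THE WINDOW (= on the `N_W`-th run) of the relabelled field `relabel (windowBondEquiv (F.P K) hNW j') U`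
is the `k₂`-fold block average of `U` in the `K`-th run, read through the level shift at level `j' + k₂`. [folklore] -/
theorem towerMap_avgFun_relabel_window (ℰ : LoopAverage G) {K NW : ℕ} (hNW : NW ≤ K) (j' k₂ : ℕ)
    (U : GaugeField (F.P K) (K - NW + j') G) :
    towerMap (fun j => (avgFun ℰ : GaugeField (F.P NW) j G → GaugeField (F.P NW) (j + 1) G)) j' k₂
        (relabel (windowBondEquiv (F.P K) hNW j') U) =
      fieldShift (sitesPerDir_windowShift F hNW j' k₂)
        (towerMap (fun j => (avgFun ℰ : GaugeField (F.P K) j G → GaugeField (F.P K) (j + 1) G)) (K - NW + j') k₂ U) := by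
  exact (congrArg (towerMap (fun j => (avgFun ℰ : GaugeField (F.P NW) j G → GaugeField (F.P NW) (j + 1) G)) j' k₂)
      (relabel_windowBondEquiv_apply F hNW j' U)).trans
    (towerMap_avgFun_fieldShift ℰ (sitesPerDir_windowShift F hNW j') k₂ U)

/-- **(o6), TWO-LEVEL AVERAGING (0.12)**: the same for `avgFun₂ 𝓜 ℰ`. [folklore] -/
theorem towerMap_avgFun₂_relabel_window (𝓜 : GroupAverage G) (ℰ : LoopAverage G) {K NW : ℕ} (hNW : NW ≤ K) (j' k₂ : ℕ)
    (U : GaugeField (F.P K) (K - NW + j') G) :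
    towerMap (fun j => (avgFun₂ 𝓜 ℰ : GaugeField (F.P NW) j G → GaugeField (F.P NW) (j + 1) G)) j' k₂
        (relabel (windowBondEquiv (F.P K) hNW j') U) =
      fieldShift (sitesPerDir_windowShift F hNW j' k₂)
        (towerMap (fun j => (avgFun₂ 𝓜 ℰ : GaugeField (F.P K) j G → GaugeField (F.P K) (j + 1) G)) (K - NW + j') k₂ U) := by
  exact (congrArg (towerMap (fun j => (avgFun₂ 𝓜 ℰ : GaugeField (F.P NW) j G → GaugeField (F.P NW) (j + 1) G)) j' k₂)
      (relabel_windowBondEquiv_apply F hNW j' U)).trans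
    (towerMap_avgFun₂_fieldShift 𝓜 ℰ (sitesPerDir_windowShift F hNW j') k₂ U)

variable {F} {K NW lvl k j' : ℕ}

/-- **(o6) IN THE SHAPE CONSUMED BY `termRepr_window(_SUN)_relabel`**: with the relabelling `ε := bondShift (hs' 0)` along ANY
modulus family `hs' i : (F.P N_W).sitesPerDir (j' + i) = (F.P K).sitesPerDir (lvl + k + i)` (e.g. `sitesPerDir_eq_of_shift F h` for
`N_W + (lvl + k) = K + j'`), the window's `k₂`-fold block averages of the relabelled `k`-fold averages of a level-`lvl` field `U` of
run `K` are run `K`'s OWN `(k + k₂)`-fold averages of `U`, relabelled onto the window at level `j' + k₂`. [folklore] -/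
theorem towerMap_relabel_towerMap (ℰ : LoopAverage G)
    (hs' : ∀ i, (F.P NW).sitesPerDir (j' + i) = (F.P K).sitesPerDir (lvl + k + i)) (k₂ : ℕ)
    (U : GaugeField (F.P K) lvl G) :
    towerMap (fun j => (avgFun ℰ : GaugeField (F.P NW) j G → GaugeField (F.P NW) (j + 1) G)) j' k₂
        (relabel (bondShift (hs' 0))
          (towerMap (fun j => (avgFun ℰ : GaugeField (F.P K) j G → GaugeField (F.P K) (j + 1) G)) lvl k U)) =
      relabel (bondShift ((hs' k₂).trans (sitesPerDir_assoc F K lvl k k₂)))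
        (towerMap (fun j => (avgFun ℰ : GaugeField (F.P K) j G → GaugeField (F.P K) (j + 1) G)) lvl (k + k₂) U) := by
  rw [relabel_bondShift, relabel_bondShift, towerMap_avgFun_fieldShift ℰ hs' k₂, towerMap_towerMap, fieldShift_fieldShift]

/-- The two-level twin of `towerMap_relabel_towerMap`. [folklore] -/
theorem towerMap_relabel_towerMap₂ (𝓜 : GroupAverage G) (ℰ : LoopAverage G)
    (hs' : ∀ i, (F.P NW).sitesPerDir (j' + i) = (F.P K).sitesPerDir (lvl + k + i)) (k₂ : ℕ)
    (U : GaugeField (F.P K) lvl G) :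
    towerMap (fun j => (avgFun₂ 𝓜 ℰ : GaugeField (F.P NW) j G → GaugeField (F.P NW) (j + 1) G)) j' k₂
        (relabel (bondShift (hs' 0))
          (towerMap (fun j => (avgFun₂ 𝓜 ℰ : GaugeField (F.P K) j G → GaugeField (F.P K) (j + 1) G)) lvl k U)) =
      relabel (bondShift ((hs' k₂).trans (sitesPerDir_assoc F K lvl k k₂)))
        (towerMap (fun j => (avgFun₂ 𝓜 ℰ : GaugeField (F.P K) j G → GaugeField (F.P K) (j + 1) G)) lvl (k + k₂) U) := by
  rw [relabel_bondShift, relabel_bondShift, towerMap_avgFun₂_fieldShift 𝓜 ℰ hs' k₂, towerMap_towerMap, fieldShift_fieldShift]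

/-- **A YOUNG SLOT VARIABLE READ THROUGH THE WINDOW**: any functional `f` of the window's `k₂`-fold averages (e.g. a plaquette
variable of a further exp-mean-log average, the young slot variables `uX K τ i` of design (W)), evaluated on the relabelled `k`-fold
averages of run `K`, is the same functional of run `K`'s own `(k + k₂)`-fold averages read through the relabelling. [folklore] -/
theorem slot_relabel_towerMap {β : Sort*} (ℰ : LoopAverage G)
    (hs' : ∀ i, (F.P NW).sitesPerDir (j' + i) = (F.P K).sitesPerDir (lvl + k + i)) (k₂ : ℕ)
    (f : GaugeField (F.P NW) (j' + k₂) G → β) (U : GaugeField (F.P K) lvl G) :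
    f (towerMap (fun j => (avgFun ℰ : GaugeField (F.P NW) j G → GaugeField (F.P NW) (j + 1) G)) j' k₂
        (relabel (bondShift (hs' 0))
          (towerMap (fun j => (avgFun ℰ : GaugeField (F.P K) j G → GaugeField (F.P K) (j + 1) G)) lvl k U))) =
      f (relabel (bondShift ((hs' k₂).trans (sitesPerDir_assoc F K lvl k k₂)))
        (towerMap (fun j => (avgFun ℰ : GaugeField (F.P K) j G → GaugeField (F.P K) (j + 1) G)) lvl (k + k₂) U)) := by
  rw [towerMap_relabel_towerMap]

end WindowTower

section Measure

variable (F : T4Family) {G : Type*} [MeasurableSpace G] [GaugeGroup G] [HaarData G]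

/-- Measure bookkeeping, by name: the window relabelling of fields carries the `K`-th run's product Haar measure at level
`K − N_W + j'` to the `N_W`-th run's product Haar measure at level `j'` EXACTLY (`map_relabel_fieldMeasure`; equivalently
`measurePreserving_fieldShift`). [folklore] -/
theorem map_relabel_windowBondEquiv_P {K NW : ℕ} (hNW : NW ≤ K) (j' : ℕ) :
    (fieldMeasure (F.P K) (K - NW + j') G).map (relabel (windowBondEquiv (F.P K) hNW j')) = fieldMeasure (F.P NW) j' G :=
  map_relabel_fieldMeasure _

/-- The same as a `MeasurePreserving` statement for the level shift. [folklore] -/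
theorem measurePreserving_relabel_windowBondEquiv {K NW : ℕ} (hNW : NW ≤ K) (j' : ℕ) :
    MeasurePreserving (relabel (G := G) (windowBondEquiv (F.P K) hNW j'))
      (fieldMeasure (F.P K) (K - NW + j') G) (fieldMeasure (F.P NW) j' G) := by
  rw [relabel_windowBondEquiv F hNW j']
  exact measurePreserving_fieldShift _

end Measure

/-! ## §5 SANITY: the records agree by `rfl`, the identities fire with numerals, labels are preserved -/

namespace Sanity

/-- A concrete family: `L = 13` (odd, `> 11`), `m = 1`. [folklore] -/
def F13 : T4Family := ⟨13, ⟨⟨6, rfl⟩, by norm_num⟩, by norm_num, 1, le_rfl⟩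

/-- The window record of depth `N_W = 2` of the `9`-th run IS the `2`-nd run's record. -/
example : window (F13.P 9) 2 = F13.P 2 := rfl

/-- … and so is the window record of the `5`-th run (`K`-independence, here by `rfl`). -/
example : window (F13.P 5) 2 = window (F13.P 9) 2 := rfl

/-- The numerology: level `0` of run `2` and level `7 = 9 − 2` of run `9` have `2·13³` sites per direction. -/
example : (F13.P 2).sitesPerDir 0 = 2 * 13 ^ 3 ∧ (F13.P 9).sitesPerDir 7 = 2 * 13 ^ 3 := by
  simp only [Params.sitesPerDir, T4Family.P_L, T4Family.P_m, T4Family.P_K]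
  show 2 * 13 ^ (1 + 2 - 0) = 2 * 13 ^ 3 ∧ 2 * 13 ^ (1 + 9 - 7) = 2 * 13 ^ 3
  norm_num

/-- The window modulus with numerals: `(run 2, level 0)` and `(run 9, level 7)`. -/
example : (F13.P 2).sitesPerDir 0 = (F13.P 9).sitesPerDir 7 := windowModulus F13 (show 2 ≤ 9 by decide) 0

/-- The window relabelling at `K = 9`, `N_W = 2`, `j' = 0` is the level shift `(run 2, level 0) ≃ (run 9, level 7)`. -/
example : windowBondEquiv (F13.P 9) (show 2 ≤ 9 by decide) 0 =
    bondShift (F := F13) (K := 2) (j := 0) (K' := 9) (j' := 7) (windowModulus F13 (show 2 ≤ 9 by decide) 0) :=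
  windowBondEquiv_P F13 _ 0

/-- It preserves integer site labels. -/
example (b : PBond (F13.P 2) 0) (ν : Fin 4) :
    ((windowBondEquiv (F13.P 9) (show 2 ≤ 9 by decide) 0 b).src ν).val = (b.src ν).val :=
  windowBondEquiv_P_src_val F13 _ 0 b ν

/-- (o6) with numerals: two further block averages on the window of the relabelled level-`7` field of run `9` are run `9`'s own
level-`9` double average, shifted. -/
example {G : Type*} [GaugeGroup G] (ℰ : LoopAverage G) (U : GaugeField (F13.P 9) 7 G) :
    towerMap (fun j => (avgFun ℰ : GaugeField (F13.P 2) j G → GaugeField (F13.P 2) (j + 1) G)) 0 2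
        (relabel (windowBondEquiv (F13.P 9) (show 2 ≤ 9 by decide) 0) U) =
      fieldShift (sitesPerDir_windowShift F13 (show 2 ≤ 9 by decide) 0 2)
        (towerMap (fun j => (avgFun ℰ : GaugeField (F13.P 9) j G → GaugeField (F13.P 9) (j + 1) G)) 7 2 U) :=
  towerMap_avgFun_relabel_window F13 ℰ (show 2 ≤ 9 by decide) 0 2 U

/-- Composition of towers with numerals: `3` steps after `4` steps from level `1` are `7` steps from level `1` (run `9`). -/
example {G : Type*} [GaugeGroup G] (ℰ : LoopAverage G) (U : GaugeField (F13.P 9) 1 G) :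
    towerMap (fun j => (avgFun ℰ : GaugeField (F13.P 9) j G → GaugeField (F13.P 9) (j + 1) G)) 5 3
        (towerMap (fun j => (avgFun ℰ : GaugeField (F13.P 9) j G → GaugeField (F13.P 9) (j + 1) G)) 1 4 U) =
      fieldShift (sitesPerDir_assoc F13 9 1 4 3)
        (towerMap (fun j => (avgFun ℰ : GaugeField (F13.P 9) j G → GaugeField (F13.P 9) (j + 1) G)) 1 7 U) :=
  towerMap_towerMap _ 1 4 3 U

end Sanity

end Literature.MathematicalPhysics.QuantumFieldTheory.Balaban1983to89.T4WindowLevelShift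

end
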